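import Mathlib
import Literature.MathematicalPhysics.QuantumFieldTheory.U1GinibreComparison
import Summits.QuantumFields.YangMills.Theses.TransverseWardBL
import Summits.QuantumFields.YangMills.Theorems.TransverseWardBLDefectTail

/-!
# `TransverseWardBL` — the small-field cut has positive mass (`0 < cutMass β M`)

Support lemma for the crux `ConvexPhaseCoexactBound` (item stmt-QuantumFields-23103) of route
`route-QuantumFields-TransverseWardBL`: the first conjunct of its conclusion,
`0 < cutMass β M = W_β[1{∀ p, cos 1 ≤ Re U_p}]`, holds for EVERY `β` and every torus side `M + 1`.

Proof: by the tree's Wilson = Ginibre identity (`wilsonExpectation_u1_eq_ginibreExpect_fun`) the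
expectation is `(∫ 1_C · w) / (∫ w)` for the continuous, strictly positive Ginibre weight `w` and the
closed cut set `C = {U | ∀ p, cos 1 ≤ Re U_p}`; the denominator is positive
(`integral_ginibreWeight_pos`) and the numerator is positive because `C` contains the open set
`O = {U | ∀ p, cos 1 < Re U_p}`, which contains the trivial configuration `U ≡ 1` and therefore has
positive product-Haar measure (Haar measure charges open sets). [folklore]
-/

open MeasureTheory Finset
open Literature.Probability.LatticeModels Literature.MathematicalPhysics.QuantumFieldTheory
open Literature.MathematicalPhysics.QuantumLattice
open Summit.QuantumFields.YangMills.Theorems.TransverseWardBLDefect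

namespace Summit.QuantumFields.YangMills.Theorems.TransverseWardBLCutMass

variable {M : ℕ}

/-- The trivial configuration has trivial plaquette holonomies. [folklore] -/
theorem plaquetteHolonomy_one (x : Site 4 (M + 1)) (i j : Fin 4) :
    plaquetteHolonomy (1 : GaugeConfig 4 (M + 1) Circle) x i j = 1 := by
  unfold plaquetteHolonomy
  simp

/-- The strict small-field set `O = {U | ∀ p, cos 1 < Re U_p}` is open. [folklore] -/
theorem isOpen_strictCut :
    IsOpen {U : GaugeConfig 4 (M + 1) Circle |
      ∀ p : Plaquette 4 (M + 1), Real.cos 1 < ((plaquetteHolonomy U p.1 p.2.1.1 p.2.1.2 : Circle) : ℂ).re} := by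
  have : {U : GaugeConfig 4 (M + 1) Circle |
      ∀ p : Plaquette 4 (M + 1), Real.cos 1 < ((plaquetteHolonomy U p.1 p.2.1.1 p.2.1.2 : Circle) : ℂ).re} =
      ⋂ p : Plaquette 4 (M + 1), {U | Real.cos 1 < reChar (u1TorusChars M p) U} := by
    ext U; simp [reChar_u1TorusChars]
  rw [this]
  exact isOpen_iInter_of_finite fun p => isOpen_lt continuous_const (continuous_reChar _)

/-- The trivial configuration lies in the strict small-field set (`cos 1 < 1`). [folklore] -/
theorem one_mem_strictCut :
    (1 : GaugeConfig 4 (M + 1) Circle) ∈ {U : GaugeConfig 4 (M + 1) Circle |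
      ∀ p : Plaquette 4 (M + 1), Real.cos 1 < ((plaquetteHolonomy U p.1 p.2.1.1 p.2.1.2 : Circle) : ℂ).re} := by
  intro p
  rw [plaquetteHolonomy_one]
  have := cos_one_lt
  simp only [Circle.coe_one, Complex.one_re]
  linarith

/-- **`0 < cutMass β M`** for every `β` and every torus side: the Wilson `U(1)₄` probability of the
small-field event `{∀ p, cos 1 ≤ Re U_p}` is strictly positive. This is the first conjunct of the
conclusion of `ConvexPhaseCoexactBound` (stmt-QuantumFields-23103), stated with the route's inlined
`cutMass` term verbatim. [folklore] -/
theorem cutMass_pos (β : ℝ) (M : ℕ) :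
    0 < (fun (β : ℝ) (M : ℕ) => Literature.MathematicalPhysics.QuantumFieldTheory.wilsonExpectation (L := M + 1) Literature.MathematicalPhysics.QuantumLattice.u1Rep β (fun U : Literature.MathematicalPhysics.QuantumFieldTheory.GaugeConfig 4 (M + 1) Circle => (if (∀ p : Literature.MathematicalPhysics.QuantumFieldTheory.Plaquette 4 (M + 1), Real.cos 1 ≤ ((Literature.MathematicalPhysics.QuantumFieldTheory.plaquetteHolonomy U p.1 p.2.1.1 p.2.1.2 : Circle) : ℂ).re) then (1 : ℝ) else 0))) β M := by
  -- abbreviations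
  set μ : Measure (GaugeConfig 4 (M + 1) Circle) := Measure.pi fun _ : Edge 4 (M + 1) => haarProbability Circle with hμ
  set F : GaugeConfig 4 (M + 1) Circle → ℝ := fun U =>
    (if (∀ p : Plaquette 4 (M + 1), Real.cos 1 ≤ ((plaquetteHolonomy U p.1 p.2.1.1 p.2.1.2 : Circle) : ℂ).re) then (1 : ℝ) else 0) with hF
  show 0 < wilsonExpectation (L := M + 1) u1Rep β F
  rw [wilsonExpectation_u1_eq_ginibreExpect_fun, ginibreExpect]
  haveI : (haarProbability Circle).IsOpenPosMeasure := by unfold haarProbability; infer_instance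
  haveI : μ.IsOpenPosMeasure := by rw [hμ]; infer_instance
  have hZpos : 0 < ∫ U, ginibreWeight (u1TorusChars M) (fun _ => β) U ∂μ := integral_ginibreWeight_pos _
  refine div_pos ?_ hZpos
  -- the numerator: `F · w ≥ 0`, integrable, with support ⊇ the open set `O ∋ 1`
  have hF01 : ∀ U, 0 ≤ F U ∧ F U ≤ 1 := fun U => by
    simp only [hF]; split_ifs <;> norm_num
  have hFmeas : Measurable F := by
    refine Measurable.ite ?_ measurable_const measurable_const
    have : {U : GaugeConfig 4 (M + 1) Circle |
        ∀ p : Plaquette 4 (M + 1), Real.cos 1 ≤ ((plaquetteHolonomy U p.1 p.2.1.1 p.2.1.2 : Circle) : ℂ).re} =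
        ⋂ p : Plaquette 4 (M + 1), {U | Real.cos 1 ≤ reChar (u1TorusChars M p) U} := by
      ext U; simp [reChar_u1TorusChars]
    rw [this]
    exact MeasurableSet.iInter fun p => measurableSet_le measurable_const (continuous_reChar _).measurable
  have hw_int : Integrable (fun U => ginibreWeight (u1TorusChars M) (fun _ => β) U) μ :=
    integrable_of_continuous_compactSpace _ (continuous_ginibreWeight _ _)
  have hFw_int : Integrable (fun U => F U * ginibreWeight (u1TorusChars M) (fun _ => β) U) μ := by
    refine hw_int.mono' (hFmeas.aestronglyMeasurable.mul (continuous_ginibreWeight _ _).aestronglyMeasurable)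
      (ae_of_all _ fun U => ?_)
    have hwpos : 0 < ginibreWeight (u1TorusChars M) (fun _ => β) U := Real.exp_pos _
    rw [Real.norm_eq_abs, abs_mul, abs_of_nonneg (hF01 U).1, abs_of_pos hwpos]
    calc F U * ginibreWeight (u1TorusChars M) (fun _ => β) U ≤ 1 * ginibreWeight (u1TorusChars M) (fun _ => β) U :=
          mul_le_mul_of_nonneg_right (hF01 U).2 hwpos.le
      _ = _ := one_mul _
  have hnn : 0 ≤ᵐ[μ] fun U => F U * ginibreWeight (u1TorusChars M) (fun _ => β) U :=
    ae_of_all _ fun U => mul_nonneg (hF01 U).1 (Real.exp_pos _).le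
  rw [integral_pos_iff_support_of_nonneg_ae hnn hFw_int]
  -- `μ(support) ≥ μ(O) > 0`
  have hO := (isOpen_strictCut (M := M)).measure_pos μ ⟨1, one_mem_strictCut⟩
  refine lt_of_lt_of_le hO (measure_mono fun U hU => ?_)
  have hUC : ∀ p : Plaquette 4 (M + 1), Real.cos 1 ≤ ((plaquetteHolonomy U p.1 p.2.1.1 p.2.1.2 : Circle) : ℂ).re :=
    fun p => (hU p).le
  have hFU : F U = 1 := by simp only [hF, if_pos hUC]
  rw [Function.mem_support, hFU, one_mul]
  exact (Real.exp_pos _).ne'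

/-- **Reduction for the 23103 prover**: with `cutMass_pos` in hand, `ConvexPhaseCoexactBound` follows from
its variance inequality alone (the positivity conjunct is discharged here). [folklore] -/
theorem convexPhaseCoexactBound_of_bound
    (h : ∃ β₁ : ℝ, ∀ β : ℝ, β₁ < β → ∀ M : ℕ, ∀ u : Literature.MathematicalPhysics.QuantumFieldTheory.Plaquette 4 (M + 1) → ℝ, (∀ e : Literature.MathematicalPhysics.QuantumFieldTheory.Edge 4 (M + 1), ∑ p : Literature.MathematicalPhysics.QuantumFieldTheory.Plaquette 4 (M + 1), (u) p * Literature.MathematicalPhysics.QuantumFieldTheory.LatticeForm.res (Literature.MathematicalPhysics.QuantumFieldTheory.LatticeForm.td₁ (fun (y : Literature.MathematicalPhysics.QuantumFieldTheory.Site 4 (M + 1)) (k : Fin 4) => if y = e.1 ∧ k = e.2 then (1 : ℝ) else 0)) p = 0) → (∀ o : {p : Fin 4 × Fin 4 // p.1 < p.2}, (∑ q : Literature.MathematicalPhysics.QuantumFieldTheory.Plaquette 4 (M + 1), (if q.2 = o then (u) q else 0)) = 0) → β * ((fun (β : ℝ) (M : ℕ) (w : Literature.MathematicalPhysics.QuantumFieldTheory.Plaquette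 4 (M + 1) → ℝ) => Literature.MathematicalPhysics.QuantumFieldTheory.wilsonExpectation (L := M + 1) Literature.MathematicalPhysics.QuantumLattice.u1Rep β (fun U : Literature.MathematicalPhysics.QuantumFieldTheory.GaugeConfig 4 (M + 1) Circle => (∑ p : Literature.MathematicalPhysics.QuantumFieldTheory.Plaquette 4 (M + 1), (w) p * ((Literature.MathematicalPhysics.QuantumFieldTheory.plaquetteHolonomy U p.1 p.2.1.1 p.2.1.2 : Circle) : ℂ).im) ^ 2 * (if (∀ p : Literature.MathematicalPhysics.QuantumFieldTheory.Plaquette 4 (M + 1), Real.cos 1 ≤ ((Literature.MathematicalPhysics.QuantumFieldTheory.plaquetteHolonomy U p.1 p.2.1.1 p.2.1.2 : Circle) : ℂ).re) then (1 : ℝ) else 0))) β M u) ≤ (9 / 20 : ℝ) * (∑ p : Literature.MathematicalPhysics.QuantumFieldTheory.Plaquette 4 (M + 1), ((u) p) ^ 2) * ((fun (β : ℝ) (M : ℕ) => Literature.MathematicalPhysics.QuantumFieldTheory.wilsonExpectation (L := M + 1) Literature.MathematicalPhysics.QuantumLattice.u1Rep β (fun U : Literature.MathematicalPhysics.QuantumFieldTheory.GaugeConfig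 4 (M + 1) Circle => (if (∀ p : Literature.MathematicalPhysics.QuantumFieldTheory.Plaquette 4 (M + 1), Real.cos 1 ≤ ((Literature.MathematicalPhysics.QuantumFieldTheory.plaquetteHolonomy U p.1 p.2.1.1 p.2.1.2 : Circle) : ℂ).re) then (1 : ℝ) else 0))) β M)) :
    Summit.QuantumFields.YangMills.Theses.TransverseWardBL.ConvexPhaseCoexactBound := by
  obtain ⟨β₁, hβ⟩ := h
  exact ⟨β₁, fun β hb M u hu hz => ⟨cutMass_pos β M, hβ β hb M u hu hz⟩⟩

end Summit.QuantumFields.YangMills.Theorems.TransverseWardBLCutMass
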